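import Mathlib
import Summits.NavierStokesRegularity.FluidComputer.TransportGalerkinAbcSolution
import HarnessLib

/-!
# Galerkin limit of the transport model, XXIII: the forced-ABC KILL word GLOBALLY IN TIME — one solution on `[0, ∞)` with exponential `H²`-decay (instab g20, cell `ns-blowup`, 2026-08-27)

HONEST FRAMING (human ruling D-0035): nothing here is a claim about Navier–Stokes blow-up.
WHAT THIS IS NOT: not NS — a MODEL theorem schema about the forced-ABC perturbation equation on
`𝕋³`; its load-bearing inputs are the Lyapunov certificates of record (interval stage not
commissioned); no number or census word moves. An `H²` (scaled phase space) statement, not `L²`.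

PURPOSE. `TransportGalerkinAbcSolution.exists_kill_solution_abc_final` (g20, part XVIII) gives, for
EVERY window `T ≥ 0`, THE classical solution on `[0, T]` from a basin seed `x` with
`‖w t‖ ≤ 2 ε e^{λt}`, unique in the class — and the KILL hypotheses (certificate + basin data) do not
involve `T`. THIS FILE patches the windows: by uniqueness in the class the solutions on `[0, T]` and
`[0, T']` agree on the overlap, so there is ONE `w : [0, ∞) → E`, continuous on `[0, ∞)`, `w 0 = x`,
`w' = F(w)` on `(0, ∞)`, in the class on every window, with `‖w t‖ ≤ 2 ε e^{λt}` for ALL `t ≥ 0`, equal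
on every `[0, T]` to every class solution from `x` (`exists_global_kill_solution_abc_final`). In words:
modulo the KILL certificate the forced ABC flow is EXPONENTIALLY ASYMPTOTICALLY STABLE in `H²` on its
basin slice (`λ < 0`) / Lyapunov stable (`λ = 0`) — global existence included. Mathlib + the tree file
cited; no new definitions.
-/

noncomputable section

open scoped ENNReal NNReal ComplexConjugate InnerProductSpace
open Set Filter Topology

namespace Summit.NavierStokesRegularity.FluidComputer.TransportGalerkinAbcGlobal

open RCLike MeasureTheory UnitAddTorus
open Literature.Analysis.FunctionSpaces Literature.Analysis.FunctionSpaces.Lattice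
open Literature.Analysis.FunctionSpaces.Torus Literature.Analysis.FunctionSpaces.EuclideanSpace
open Literature.Analysis.ODE Literature.Analysis.FluidPDE
open Summit.NavierStokesRegularity.FluidComputer.TransportGalerkin
open Summit.NavierStokesRegularity.FluidComputer.TransportGalerkinAbc
open Summit.NavierStokesRegularity.FluidComputer.TransportGalerkinAbcSolution

/-- **The forced-ABC KILL word, globally in time** (`exists_global_kill_solution_abc_final`): from
`ν > 0`, a rapidly decreasing constrained seed `x`, the certificate objects/inequalities at levels `≥ K`
(g18's list verbatim), the rate block (`ω < 2λ ≤ 0`, `ω₁ ≤ λ`) and the basin data (`√(M/m)‖x‖ < ε`,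
`4Cε < 1`): ONE classical solution `w` of the model on `[0, ∞)` from `x` — continuous on `[0, ∞)`,
`w' = F(w)` on `(0, ∞)`, with the three clauses and, on every window `[0, T]`, a uniform polynomial tail
of scaled order `6` — obeying `‖w t‖ ≤ 2 ε e^{λt}` for every `t ≥ 0`, and agreeing on every `[0, T]` with
every classical solution in the class from `x`. -/
theorem exists_global_kill_solution_abc_final (K : ℕ) (A B C : ℝ) {ν : ℝ} (hν : 0 < ν)
    {x : lp (fun _ : (Fin 3 → ℤ) => EuclideanSpace ℂ (Fin 3)) 2} (hxr : RapidDecay (⇑x))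
    (hxfix : ∀ k, lerayCLM k (x k) = x k)
    (hxreal : ∀ (j : Fin 3) (k : Fin 3 → ℤ), (EuclideanSpace.proj j : EuclideanSpace ℂ (Fin 3) →L[ℂ] ℂ) (x (-k)) =
      conj ((EuclideanSpace.proj j : EuclideanSpace ℂ (Fin 3) →L[ℂ] ℂ) (x k)))
    (hxdiv : ∀ k : Fin 3 → ℤ, ∑ j, ((k j : ℤ) : ℂ) * (EuclideanSpace.proj j : EuclideanSpace ℂ (Fin 3) →L[ℂ] ℂ) (x k) = 0)
    {μt : ℝ}
    {G₁ G₂ G : lp (fun _ : (Fin 3 → ℤ) => EuclideanSpace ℂ (Fin 3)) 2 →L[ℝ]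
      lp (fun _ : (Fin 3 → ℤ) => EuclideanSpace ℂ (Fin 3)) 2}
    (hG₁ : ∀ x y : lp (fun _ : (Fin 3 → ℤ) => EuclideanSpace ℂ (Fin 3)) 2, ⟪G₁ x, y⟫_ℂ = ⟪x, G₁ y⟫_ℂ)
    (hG₂ : ∀ x y : lp (fun _ : (Fin 3 → ℤ) => EuclideanSpace ℂ (Fin 3)) 2, ⟪G₂ x, y⟫_ℂ = ⟪x, G₂ y⟫_ℂ)
    (hG : ∀ x y : lp (fun _ : (Fin 3 → ℤ) => EuclideanSpace ℂ (Fin 3)) 2, ⟪G x, y⟫_ℂ = ⟪x, G y⟫_ℂ)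
    (hG₁P : ∀ n, ∀ w z : lp (fun _ : (Fin 3 → ℤ) => EuclideanSpace ℂ (Fin 3)) 2,
      ⟪G₁ w, cubeProj (n + K) z⟫_ℂ = ⟪G₁ (cubeProj (n + K) w), z⟫_ℂ)
    (hG₂P : ∀ n, ∀ w z : lp (fun _ : (Fin 3 → ℤ) => EuclideanSpace ℂ (Fin 3)) 2,
      ⟪G₂ w, cubeProj (n + K) z⟫_ℂ = ⟪G₂ (cubeProj (n + K) w), z⟫_ℂ)
    (hGP : ∀ n, ∀ w z : lp (fun _ : (Fin 3 → ℤ) => EuclideanSpace ℂ (Fin 3)) 2,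
      ⟪G w, cubeProj (n + K) z⟫_ℂ = ⟪G (cubeProj (n + K) w), z⟫_ℂ)
    (hG₁pos : ∀ x : lp (fun _ : (Fin 3 → ℤ) => EuclideanSpace ℂ (Fin 3)) 2, 0 ≤ re ⟪G₁ x, x⟫_ℂ)
    {ω c m₂ M₁ : ℝ} (hc : 0 < c) (hm₂ : 0 < m₂) (hM₁ : 0 ≤ M₁)
    (hm₂' : ∀ x : lp (fun _ : (Fin 3 → ℤ) => EuclideanSpace ℂ (Fin 3)) 2, m₂ * ‖x‖ ^ 2 ≤ re ⟪G₂ x, x⟫_ℂ)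
    (hM₁' : ∀ x : lp (fun _ : (Fin 3 → ℤ) => EuclideanSpace ℂ (Fin 3)) 2,
      re ⟪G₁ x, x⟫_ℂ ≤ M₁ * (eNormSq (-1) (⇑x)).toReal)
    {m M ω₁ : ℝ} (hm0 : 0 < m)
    (hm : ∀ x : lp (fun _ : (Fin 3 → ℤ) => EuclideanSpace ℂ (Fin 3)) 2, m * ‖x‖ ^ 2 ≤ re ⟪G x, x⟫_ℂ)
    (hM : ∀ x : lp (fun _ : (Fin 3 → ℤ) => EuclideanSpace ℂ (Fin 3)) 2, re ⟪G x, x⟫_ℂ ≤ M * ‖x‖ ^ 2)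
    (h₁ : ∀ n, ∀ w : lp (fun _ : (Fin 3 → ℤ) => EuclideanSpace ℂ (Fin 3)) 2,
      2 * re ⟪G₁ (cubeProj (n + K) w), linOp ν (mFourierCoeff (EuclideanSpace.complexify ∘ Torus.abcFlow A B C))
        (fun j => (EuclideanSpace.proj j : EuclideanSpace ℂ (Fin 3) →L[ℂ] ℂ)) lerayCLM (cubeProj (n + K) w)⟫_ℂ +
        c * re ⟪G₂ (cubeProj (n + K) w), cubeProj (n + K) w⟫_ℂ ≤ 2 * ω * re ⟪G₁ (cubeProj (n + K) w), cubeProj (n + K) w⟫_ℂ)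
    (h₂ : ∀ n, ∀ w : lp (fun _ : (Fin 3 → ℤ) => EuclideanSpace ℂ (Fin 3)) 2,
      re ⟪G₂ (cubeProj (n + K) w), linOp ν (mFourierCoeff (EuclideanSpace.complexify ∘ Torus.abcFlow A B C))
        (fun j => (EuclideanSpace.proj j : EuclideanSpace ℂ (Fin 3) →L[ℂ] ℂ)) lerayCLM (cubeProj (n + K) w)⟫_ℂ ≤
        ω * re ⟪G₂ (cubeProj (n + K) w), cubeProj (n + K) w⟫_ℂ)
    (hL : ∀ n, ∀ w : lp (fun _ : (Fin 3 → ℤ) => EuclideanSpace ℂ (Fin 3)) 2,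
      re ⟪G (cubeProj (n + K) w), linOp ν (mFourierCoeff (EuclideanSpace.complexify ∘ Torus.abcFlow A B C))
        (fun j => (EuclideanSpace.proj j : EuclideanSpace ℂ (Fin 3) →L[ℂ] ℂ)) lerayCLM (cubeProj (n + K) w)⟫_ℂ ≤
        ω₁ * re ⟪G (cubeProj (n + K) w), cubeProj (n + K) w⟫_ℂ)
    (hμ₁ : μt ≤ ω₁) (hμ₂ : μt ≤ ω)
    (htail : ∀ n, ∀ q : lp (fun _ : (Fin 3 → ℤ) => EuclideanSpace ℂ (Fin 3)) 2, cubeProj (n + K) q = 0 →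
      2 * μt * re ⟪G₁ q, q⟫_ℂ + c * re ⟪G₂ q, q⟫_ℂ ≤ 2 * ω * re ⟪G₁ q, q⟫_ℂ)
    {lam : ℝ} (hgap : ω < 2 * lam) (hlam : lam ≤ 0) (hrate : ω₁ ≤ lam)
    {ε : ℝ} (hε : 0 < ε) (hseed : Real.sqrt (M / m) * ‖x‖ < ε)
    (hbasin : 4 * (Real.sqrt (M₁ / (c * m₂)) * (2 * ((Fintype.card (Fin 3) : ℝ) * (2 * Real.pi)) *
        Real.sqrt ((∑' l : Fin 3 → ℤ, ENNReal.ofReal (sobolevWeight (-2) l ^ 2)).toReal)) *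
        Real.sqrt (Real.pi / (2 * lam - ω))) * ε < 1) :
    ∃ w : ℝ → lp (fun _ : (Fin 3 → ℤ) => EuclideanSpace ℂ (Fin 3)) 2,
      ContinuousOn w (Ici 0) ∧ w 0 = x ∧
      (∀ t, 0 < t → HasDerivAt w (nsField ν (mFourierCoeff (EuclideanSpace.complexify ∘ Torus.abcFlow A B C))
            (fun j => (EuclideanSpace.proj j : EuclideanSpace ℂ (Fin 3) →L[ℂ] ℂ)) lerayCLM (w t)) t) ∧
      (∀ T, 0 ≤ T → ∃ Cw : ℝ, 0 ≤ Cw ∧ ∀ t ∈ Icc 0 T, ∀ k, ‖(w t : (Fin 3 → ℤ) → EuclideanSpace ℂ (Fin 3)) k‖ ≤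
        Cw * sobolevWeight (-((Fintype.card (Fin 3) : ℝ) + 3)) k) ∧
      (∀ t, 0 ≤ t → ∀ k, lerayCLM k ((w t : (Fin 3 → ℤ) → EuclideanSpace ℂ (Fin 3)) k) =
        (w t : (Fin 3 → ℤ) → EuclideanSpace ℂ (Fin 3)) k) ∧
      (∀ t, 0 ≤ t → ∀ (j : Fin 3) (k : Fin 3 → ℤ),
        (EuclideanSpace.proj j : EuclideanSpace ℂ (Fin 3) →L[ℂ] ℂ) ((w t : (Fin 3 → ℤ) → EuclideanSpace ℂ (Fin 3)) (-k)) =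
          conj ((EuclideanSpace.proj j : EuclideanSpace ℂ (Fin 3) →L[ℂ] ℂ) ((w t : (Fin 3 → ℤ) → EuclideanSpace ℂ (Fin 3)) k))) ∧
      (∀ t, 0 ≤ t → ∀ k : Fin 3 → ℤ,
        ∑ j, ((k j : ℤ) : ℂ) * (EuclideanSpace.proj j : EuclideanSpace ℂ (Fin 3) →L[ℂ] ℂ)
          ((w t : (Fin 3 → ℤ) → EuclideanSpace ℂ (Fin 3)) k) = 0) ∧
      (∀ t, 0 ≤ t → ‖w t‖ ≤ 2 * (ε * Real.exp (lam * t))) ∧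
      ∀ {T : ℝ} (_hT : 0 ≤ T) {w' : ℝ → lp (fun _ : (Fin 3 → ℤ) => EuclideanSpace ℂ (Fin 3)) 2} (_hw' : ContinuousOn w' (Icc 0 T))
        (_hw'0 : w' 0 = x)
        (_hw'' : ∀ t ∈ Ioo 0 T, HasDerivAt w' (nsField ν (mFourierCoeff (EuclideanSpace.complexify ∘ Torus.abcFlow A B C))
            (fun j => (EuclideanSpace.proj j : EuclideanSpace ℂ (Fin 3) →L[ℂ] ℂ)) lerayCLM (w' t)) t)
        {C'w : ℝ} (_hC'w : 0 ≤ C'w)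
        (_hw'dec : ∀ t ∈ Icc 0 T, ∀ k, ‖(w' t : (Fin 3 → ℤ) → EuclideanSpace ℂ (Fin 3)) k‖ ≤
          C'w * sobolevWeight (-((Fintype.card (Fin 3) : ℝ) + 3)) k)
        (_hw'fix : ∀ t ∈ Icc 0 T, ∀ k, lerayCLM k ((w' t : (Fin 3 → ℤ) → EuclideanSpace ℂ (Fin 3)) k) =
          (w' t : (Fin 3 → ℤ) → EuclideanSpace ℂ (Fin 3)) k)
        (_hw'real : ∀ t ∈ Icc 0 T, ∀ (j : Fin 3) (k : Fin 3 → ℤ),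
          (EuclideanSpace.proj j : EuclideanSpace ℂ (Fin 3) →L[ℂ] ℂ) ((w' t : (Fin 3 → ℤ) → EuclideanSpace ℂ (Fin 3)) (-k)) =
            conj ((EuclideanSpace.proj j : EuclideanSpace ℂ (Fin 3) →L[ℂ] ℂ) ((w' t : (Fin 3 → ℤ) → EuclideanSpace ℂ (Fin 3)) k)))
        (_hw'div : ∀ t ∈ Icc 0 T, ∀ k : Fin 3 → ℤ,
          ∑ j, ((k j : ℤ) : ℂ) * (EuclideanSpace.proj j : EuclideanSpace ℂ (Fin 3) →L[ℂ] ℂ)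
            ((w' t : (Fin 3 → ℤ) → EuclideanSpace ℂ (Fin 3)) k) = 0),
        EqOn w' w (Icc 0 T) := by
  -- for every window, THE solution on it
  have H := fun (T : ℝ) (hT : 0 ≤ T) => exists_kill_solution_abc_final K A B C hν hT hxr hxfix hxreal hxdiv hG₁ hG₂
    hG hG₁P hG₂P hGP hG₁pos hc hm₂ hM₁ hm₂' hM₁' hm0 hm hM h₁ h₂ hL hμ₁ hμ₂ htail hgap hlam hrate hε hseed hbasin
  choose S hS using H
  -- the patched trajectory
  set W : ℝ → lp (fun _ : (Fin 3 → ℤ) => EuclideanSpace ℂ (Fin 3)) 2 := fun t => if ht : 0 ≤ t then S t ht t else x with hW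
  -- windows agree: `W = S T` on `[0, T]`
  have hWS : ∀ T (hT : 0 ≤ T), ∀ t ∈ Icc 0 T, W t = S T hT t := by
    intro T hT t ht
    have ht0 : 0 ≤ t := ht.1
    have hWt : W t = S t ht0 t := by simp only [hW, dif_pos ht0]
    rw [hWt]
    -- `S T` restricted to `[0, t]` is a class solution from `x` on `[0, t]`: uniqueness of `S t`
    obtain ⟨hc', h0', hd', ⟨Cw, hCw, htl⟩, hfx, hrl, hdv, -, -⟩ := hS T hT
    obtain ⟨-, -, -, -, -, -, -, -, huniq⟩ := hS t ht0
    have heq : EqOn (S T hT) (S t ht0) (Icc 0 t) :=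
      huniq (hc'.mono (Icc_subset_Icc_right ht.2)) h0'
        (fun s hs => hd' s ⟨hs.1, hs.2.trans_le ht.2⟩) hCw
        (fun s hs => htl s ⟨hs.1, hs.2.trans ht.2⟩) (fun s hs => hfx s ⟨hs.1, hs.2.trans ht.2⟩)
        (fun s hs => hrl s ⟨hs.1, hs.2.trans ht.2⟩) (fun s hs => hdv s ⟨hs.1, hs.2.trans ht.2⟩)
    exact (heq ⟨ht0, le_rfl⟩).symm
  refine ⟨W, ?_, ?_, ?_, ?_, ?_, ?_, ?_, ?_, ?_⟩
  · -- continuity on `[0, ∞)`: locally `W = S (t + 1)`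
    intro t ht
    have ht0 : (0 : ℝ) ≤ t := ht
    obtain ⟨hc', -, -, -, -, -, -, -, -⟩ := hS (t + 1) (by linarith)
    have hloc : ContinuousWithinAt (S (t + 1) (by linarith)) (Icc 0 (t + 1)) t := hc' t ⟨ht0, by linarith⟩
    have hmem : Icc 0 (t + 1) ∈ 𝓝[Ici 0] t := by
      refine mem_nhdsWithin.2 ⟨Iio (t + 1), isOpen_Iio, by simp, fun s hs => ⟨hs.2, le_of_lt hs.1⟩⟩
    refine (hloc.mono_of_mem_nhdsWithin hmem).congr_of_eventuallyEq ?_ (hWS (t + 1) (by linarith) t ⟨ht0, by linarith⟩)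
    filter_upwards [self_mem_nhdsWithin, mem_nhdsWithin_of_mem_nhds (Iio_mem_nhds (by linarith : t < t + 1))]
      with s hs hs' using hWS (t + 1) (by linarith) s ⟨hs, le_of_lt hs'⟩
  · -- initial value
    obtain ⟨-, h0', -, -, -, -, -, -, -⟩ := hS 0 le_rfl
    rw [hWS 0 le_rfl 0 ⟨le_rfl, le_rfl⟩, h0']
  · -- the equation on `(0, ∞)`: locally `W = S (t + 1)`
    intro t ht
    obtain ⟨-, -, hd', -, -, -, -, -, -⟩ := hS (t + 1) (by linarith)
    have hder := hd' t ⟨ht, by linarith⟩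
    have hev : W =ᶠ[𝓝 t] S (t + 1) (by linarith) := by
      filter_upwards [Ioo_mem_nhds ht (by linarith : t < t + 1)] with s hs using
        hWS (t + 1) (by linarith) s ⟨hs.1.le, hs.2.le⟩
    rw [hev.hasDerivAt_iff]
    rwa [hWS (t + 1) (by linarith) t ⟨ht.le, by linarith⟩]
  · -- the tail on every window
    intro T hT
    obtain ⟨-, -, -, ⟨Cw, hCw, htl⟩, -, -, -, -, -⟩ := hS T hT
    exact ⟨Cw, hCw, fun t ht k => by rw [hWS T hT t ht]; exact htl t ht k⟩
  · intro t ht k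
    obtain ⟨-, -, -, -, hfx, -, -, -, -⟩ := hS t ht
    rw [hWS t ht t ⟨ht, le_rfl⟩]; exact hfx t ⟨ht, le_rfl⟩ k
  · intro t ht j k
    obtain ⟨-, -, -, -, -, hrl, -, -, -⟩ := hS t ht
    rw [hWS t ht t ⟨ht, le_rfl⟩]; exact hrl t ⟨ht, le_rfl⟩ j k
  · intro t ht k
    obtain ⟨-, -, -, -, -, -, hdv, -, -⟩ := hS t ht
    rw [hWS t ht t ⟨ht, le_rfl⟩]; exact hdv t ⟨ht, le_rfl⟩ k
  · -- the decay for all `t ≥ 0`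
    intro t ht
    obtain ⟨-, -, -, -, -, -, -, hdec, -⟩ := hS t ht
    rw [hWS t ht t ⟨ht, le_rfl⟩]; exact hdec t ⟨ht, le_rfl⟩
  · -- uniqueness on every window
    intro T hT w' hw'c hw'0 hw'' C'w hC'w hw'dec hw'fix hw'real hw'div
    obtain ⟨-, -, -, -, -, -, -, -, huniq⟩ := hS T hT
    intro t ht
    rw [hWS T hT t ht]
    exact huniq hw'c hw'0 hw'' hC'w hw'dec hw'fix hw'real hw'div ht

end Summit.NavierStokesRegularity.FluidComputer.TransportGalerkinAbcGlobal

end
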